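import Literature.Topology.FourManifolds.CerfBirthDeath
import HarnessLib

/-!
# The indicatrix through a birth–death point: Cerf's relations (9)–(10) and Lemme 8

Topic `Literature/Topology/FourManifolds` (programme of the fact
`Literature.Topology.FourManifolds.cerf_pi0DiffDisc_relBoundary_three`, brick C1), continuation of
`CerfBirthDeath.lean`.  J. Cerf, *Sur les difféomorphismes de la sphère de dimension trois
(Γ₄ = 0)*, LNM 53 (1968), Ch. II §2, 2°–4° (book pp. 14–17).  Along the indicatrix
`u ↦ (λ(u), x(u), y(u))` of a correct path near a point with horizontal tangent Cerf derives

> (9) `dλ/du = δ`; `d²λ/du² = dδ/du ≠ 0`,  (10) `dz/du = μ dλ/du`, `dμ/du = -D₂²/r ≠ 0`,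

whence the cusp of the graphic and (Lemme 8) its local injectivity.  Here, for the
parametrisation `(u, s) ↦ z₀ + (T(u,s), s k + A(u,s) k′)` of the critical points of a smooth
one-parameter family of paths `F u` produced by `CerfBirthDeath.exists_indicatrix`, we prove the
`s`-derivative identities behind (9)–(10) at every nearby parameter (§1: `∂ₛT ⟨∂λ∇F, k⟩ = -⟨H w, k⟩`
componentwise, `∂ₛ(F ∘ γ) = μ ∂ₛT`, the formula for `∂ₛμ`), the values at the birth–death point
(§2: `∂ₛμ(0) = ⟨∂λ∇F, k⟩ ≠ 0` and `∂ₛ∂ₛT(0) ⟨∂λ∇F, k⟩ = -C ≠ 0`, `C` the cubic form on the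
kernel), and (§3) **Lemme 8 uniformly in `u`**: for `|u|, |s₁|, |s₂|` small, `s₁ ≠ s₂` and
`T(u, s₁) = T(u, s₂)` imply `F u (γ(u, s₁)) ≠ F u (γ(u, s₂))` — two distinct critical points of
one slice near the birth–death point have distinct critical values.

Everything is proved; the only definition is `indPt` (the point of the indicatrix).

## References

* J. Cerf, *Sur les difféomorphismes de la sphère de dimension trois (Γ₄ = 0)*, LNM 53 (1968),
  Ch. II §2, 2°–4°, (9), (10), Lemme 8. [CerfDiffeoSphere1968]
-/

noncomputable section

open Set Function Filter Module Metric
open scoped ContDiff Topology BigOperators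

namespace Literature.Topology.FourManifolds

namespace CerfPath

open Literature.Analysis.Calculus Literature.Analysis.Calculus.ParametricTransversality

/-- Local notation for this file: the model plane `ℝ² = EuclideanSpace ℝ (Fin 2)`. -/
local notation "𝔼²" => EuclideanSpace ℝ (Fin 2)

/-- The point of the indicatrix with parameters `y = (u, s)`:
`γ(y) = z₀ + (T(y), s k + A(y) k′)` where `g = (T, A)`. [cite: CerfDiffeoSphere1968, Ch. II §2, 2°] -/
def indPt (z₀ : ℝ × 𝔼²) (k : 𝔼²) (g : ℝ × ℝ → ℝ × ℝ) (y : ℝ × ℝ) : ℝ × 𝔼² :=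
  z₀ + ((g y).1, y.2 • k + (g y).2 • rot k)

/-- Unfolding of `indPt`. [folklore] -/
theorem indPt_apply (z₀ : ℝ × 𝔼²) (k : 𝔼²) (g : ℝ × ℝ → ℝ × ℝ) (y : ℝ × ℝ) :
    indPt z₀ k g y = z₀ + ((g y).1, y.2 • k + (g y).2 • rot k) := rfl

/-! ### Slices in the `s`-direction and the derivative of the indicatrix -/

section SliceS

variable {V : Type*} [NormedAddCommGroup V] [NormedSpace ℝ V]

/-- The `s`-slice of a differentiable map of `(u, s)` has derivative `Dh(u, s)(0, 1)`.
[folklore] -/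
theorem hasDerivAt_sliceS {h : ℝ × ℝ → V} {y : ℝ × ℝ} {L : ℝ × ℝ →L[ℝ] V}
    (hh : HasFDerivAt h L y) : HasDerivAt (fun s => h (y.1, s)) (L (0, 1)) y.2 := by
  have h1 : HasDerivAt (fun s : ℝ => (y.1, s)) ((0 : ℝ), (1 : ℝ)) y.2 := by
    have := (hasDerivAt_const y.2 y.1).prodMk (hasDerivAt_id y.2)
    simpa using this
  have h2 : HasFDerivAt h L ((fun s : ℝ => (y.1, s)) y.2) := by simpa using hh
  exact h2.comp_hasDerivAt y.2 h1

end SliceS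

section IndPt

variable {z₀ : ℝ × 𝔼²} {k : 𝔼²} {g : ℝ × ℝ → ℝ × ℝ}

/-- The derivative of the indicatrix point: `Dγ(y) ẏ = ((Dg ẏ)₁, ẏ₂ k + (Dg ẏ)₂ k′)`.
[folklore] -/
theorem hasFDerivAt_indPt {y : ℝ × ℝ} {g' : ℝ × ℝ →L[ℝ] ℝ × ℝ} (hg : HasFDerivAt g g' y) :
    HasFDerivAt (indPt z₀ k g)
      ((ContinuousLinearMap.fst ℝ ℝ ℝ ∘L g').prod
        ((ContinuousLinearMap.snd ℝ ℝ ℝ).smulRight k +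
          (ContinuousLinearMap.snd ℝ ℝ ℝ ∘L g').smulRight (rot k))) y := by
  unfold indPt
  have h1 : HasFDerivAt (fun y => (g y).1) (ContinuousLinearMap.fst ℝ ℝ ℝ ∘L g') y :=
    hasFDerivAt_fst.comp y hg
  have h2 : HasFDerivAt (fun y : ℝ × ℝ => y.2 • k) ((ContinuousLinearMap.snd ℝ ℝ ℝ).smulRight k) y :=
    hasFDerivAt_snd.smul_const k
  have h3 : HasFDerivAt (fun y => (g y).2 • rot k)
      ((ContinuousLinearMap.snd ℝ ℝ ℝ ∘L g').smulRight (rot k)) y :=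
    (hasFDerivAt_snd.comp y hg).smul_const (rot k)
  exact (h1.prodMk (h2.add h3)).const_add z₀

/-- The `s`-derivative of the indicatrix point: `∂ₛγ = (∂ₛT, k + ∂ₛA k′)`. [folklore] -/
theorem fderiv_indPt_apply_s {y : ℝ × ℝ} (hg : DifferentiableAt ℝ g y) :
    fderiv ℝ (indPt z₀ k g) y (0, 1) =
      ((fderiv ℝ g y (0, 1)).1, k + (fderiv ℝ g y (0, 1)).2 • rot k) := by
  rw [(hasFDerivAt_indPt hg.hasFDerivAt).fderiv]
  simp

end IndPt

/-! ### The `s`-derivative identities along the indicatrix (Cerf's (9), (10)) -/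

section Identities

variable {F : ℝ → ℝ × 𝔼² → ℝ} {z₀ : ℝ × 𝔼²} {k : 𝔼²} {g : ℝ × ℝ → ℝ × ℝ} {N : Set (ℝ × ℝ)}

/-- **Differentiating `p = q = 0` along the indicatrix** (Cerf's 1°–2°, componentwise): on an
open set of parameters where the critical-point identity holds and `g = (T, A)` is
differentiable, `∂ₛT · ∂λ∂ᵢF + (H (k + ∂ₛA k′))ᵢ = 0` for `i = 0, 1`.
[cite: CerfDiffeoSphere1968, Ch. II §2, 1°–2° and (9)] -/
theorem dT_mul_d1t_add_hessMul (hF : ContDiff ℝ ∞ fun p : ℝ × (ℝ × 𝔼²) => F p.1 p.2)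
    (hN : IsOpen N) (hg : ∀ y ∈ N, DifferentiableAt ℝ g y)
    (hE : ∀ y ∈ N, d1 (F y.1) (indPt z₀ k g y) = 0) {y : ℝ × ℝ} (hy : y ∈ N) (i : Fin 2) :
    (fderiv ℝ g y (0, 1)).1 * d1t (F y.1) (indPt z₀ k g y) i +
      hessMul (F y.1) (indPt z₀ k g y) (k + (fderiv ℝ g y (0, 1)).2 • rot k) i = 0 := by
  -- the component `eᵢ(y) = ∂ᵢ(F y.1)(γ y)` vanishes on `N`, hence so does its derivative
  have hzero : fderiv ℝ (fun y => d1 (F y.1) (indPt z₀ k g y) i) y = 0 := by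
    have hev : (fun y => d1 (F y.1) (indPt z₀ k g y) i) =ᶠ[𝓝 y] fun _ => (0 : ℝ) := by
      filter_upwards [hN.mem_nhds hy] with y' hy'
      have := congrFun (hE y' hy') i
      simpa using this
    rw [hev.fderiv_eq]; exact fderiv_const_apply 0
  -- chain rule through `(u, z) ↦ ∂ᵢ(F u)(z)`
  have hG : HasFDerivAt (fun p : ℝ × (ℝ × 𝔼²) => d1 (F p.1) p.2 i)
      (fderiv ℝ (fun p : ℝ × (ℝ × 𝔼²) => d1 (F p.1) p.2 i) (y.1, indPt z₀ k g y))
      (y.1, indPt z₀ k g y) :=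
    ((contDiff_d1_member hF i).differentiable (by simp) _).hasFDerivAt
  have hinner : HasFDerivAt (fun y : ℝ × ℝ => (y.1, indPt z₀ k g y))
      ((ContinuousLinearMap.fst ℝ ℝ ℝ).prod (fderiv ℝ (indPt z₀ k g) y)) y :=
    hasFDerivAt_fst.prodMk ((hasFDerivAt_indPt (hg y hy).hasFDerivAt).differentiableAt.hasFDerivAt)
  have hcomp := hG.comp y hinner
  have hzero' : fderiv ℝ ((fun p : ℝ × (ℝ × 𝔼²) => d1 (F p.1) p.2 i) ∘
      fun y : ℝ × ℝ => (y.1, indPt z₀ k g y)) y = 0 := hzero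
  have happ := congrArg (fun L : ℝ × ℝ →L[ℝ] ℝ => L (0, 1)) hcomp.fderiv
  rw [hzero'] at happ
  simp only [ContinuousLinearMap.comp_apply, ContinuousLinearMap.prod_apply,
    ContinuousLinearMap.coe_fst'] at happ
  rw [fderiv_indPt_apply_s (hg y hy), fderiv_d1_member_apply hF, zero_mul, zero_add,
    fderiv_d1_apply (contDiff_member hF y.1) two_le_infty,
    sum_mul_d2_eq_hessMul (contDiff_member hF y.1)] at happ
  have h0 : (0 : ℝ × ℝ →L[ℝ] ℝ) (0, 1) = 0 := rfl
  rw [h0] at happ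
  exact happ.symm

/-- **Cerf's (9): `∂ₛT ⟨∂λ∇F, k⟩ = -⟨H (k + ∂ₛA k′), k⟩`** (inner product of the previous identity
with the kernel direction). [cite: CerfDiffeoSphere1968, Ch. II §2, (9)] -/
theorem dT_mul_sum_eq (hF : ContDiff ℝ ∞ fun p : ℝ × (ℝ × 𝔼²) => F p.1 p.2)
    (hN : IsOpen N) (hg : ∀ y ∈ N, DifferentiableAt ℝ g y)
    (hE : ∀ y ∈ N, d1 (F y.1) (indPt z₀ k g y) = 0) {y : ℝ × ℝ} (hy : y ∈ N) :
    (fderiv ℝ g y (0, 1)).1 * (∑ i, k i * d1t (F y.1) (indPt z₀ k g y) i) =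
      -(∑ i, k i * hessMul (F y.1) (indPt z₀ k g y) (k + (fderiv ℝ g y (0, 1)).2 • rot k) i) := by
  have h0 := dT_mul_d1t_add_hessMul hF hN hg hE hy 0
  have h1 := dT_mul_d1t_add_hessMul hF hN hg hE hy 1
  simp only [Fin.sum_univ_two]
  linear_combination k 0 * h0 + k 1 * h1

/-- **Cerf's (10): `∂ₛ(F u ∘ γ) = μ · ∂ₛT`** — along the indicatrix the critical value varies as
`μ dλ` ("`dz/du = μ δ`", with `dλ/du = δ`). [cite: CerfDiffeoSphere1968, Ch. II §2, (10)] -/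
theorem fderiv_value_apply_s (hF : ContDiff ℝ ∞ fun p : ℝ × (ℝ × 𝔼²) => F p.1 p.2)
    {y : ℝ × ℝ} (hg : DifferentiableAt ℝ g y) (hE : d1 (F y.1) (indPt z₀ k g y) = 0) :
    fderiv ℝ (fun y => F y.1 (indPt z₀ k g y)) y (0, 1) =
      dt (F y.1) (indPt z₀ k g y) * (fderiv ℝ g y (0, 1)).1 := by
  have hJ : HasFDerivAt (fun p : ℝ × (ℝ × 𝔼²) => F p.1 p.2)
      (fderiv ℝ (fun p : ℝ × (ℝ × 𝔼²) => F p.1 p.2) (y.1, indPt z₀ k g y))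
      (y.1, indPt z₀ k g y) := (hF.differentiable (by simp) _).hasFDerivAt
  have hinner : HasFDerivAt (fun y : ℝ × ℝ => (y.1, indPt z₀ k g y))
      ((ContinuousLinearMap.fst ℝ ℝ ℝ).prod (fderiv ℝ (indPt z₀ k g) y)) y :=
    hasFDerivAt_fst.prodMk ((hasFDerivAt_indPt hg.hasFDerivAt).differentiableAt.hasFDerivAt)
  have hcomp : HasFDerivAt (fun y => F y.1 (indPt z₀ k g y))
      (fderiv ℝ (fun p : ℝ × (ℝ × 𝔼²) => F p.1 p.2) (y.1, indPt z₀ k g y) ∘L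
        (ContinuousLinearMap.fst ℝ ℝ ℝ).prod (fderiv ℝ (indPt z₀ k g) y)) y := by
    have h := hJ.comp y hinner; exact h
  rw [hcomp.fderiv]
  simp only [ContinuousLinearMap.comp_apply, ContinuousLinearMap.prod_apply,
    ContinuousLinearMap.coe_fst']
  rw [fderiv_indPt_apply_s hg]
  -- split the joint derivative into `u`- and `z`-parts; the `u`-part is hit by `0`
  have hsplit := apply_eq_inl_add_inr
    (fderiv ℝ (fun p : ℝ × (ℝ × 𝔼²) => F p.1 p.2) (y.1, indPt z₀ k g y)) (0 : ℝ)
    (((fderiv ℝ g y (0, 1)).1, k + (fderiv ℝ g y (0, 1)).2 • rot k) : ℝ × 𝔼²)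
  rw [hsplit, map_zero, zero_add]
  have hz : fderiv ℝ (fun p : ℝ × (ℝ × 𝔼²) => F p.1 p.2) (y.1, indPt z₀ k g y) ∘L
      ContinuousLinearMap.inr ℝ ℝ (ℝ × 𝔼²) = fderiv ℝ (F y.1) (indPt z₀ k g y) := by
    rw [fderiv_member_eq hF y.1]
  rw [hz, clm_apply_eq]
  have hd1 : ∀ j, fderiv ℝ (F y.1) (indPt z₀ k g y) (dir j) = 0 := fun j => by
    have := congrFun hE j
    simpa [d1] using this
  simp [hd1, dt, smul_eq_mul, mul_comm]

/-- The derivative of `μ = ∂λF` in a general direction `(τ, x)`: `τ ∂λμ + ∑ xⱼ ∂λ∂ⱼF`.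
[folklore] -/
theorem fderiv_dt_apply {f : ℝ × 𝔼² → ℝ} (hf : ContDiff ℝ ∞ f) (z : ℝ × 𝔼²) (τ : ℝ) (x : 𝔼²) :
    fderiv ℝ (fun z => dt f z) z (τ, x) =
      τ * fderiv ℝ (fun z => dt f z) z (1, 0) + ∑ j, x j * d1t f z j := by
  have h1 : HasFDerivAt (fun z => dt f z) ((fderiv ℝ (fderiv ℝ f) z).flip (1, 0)) z :=
    hasFDerivAt_fderiv_apply_const hf two_le_infty z (1, 0)
  have hsplit : ((τ, x) : ℝ × 𝔼²) = ((τ, (0 : 𝔼²)) : ℝ × 𝔼²) + ((0 : ℝ), x) := by simp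
  rw [hsplit, map_add, fderiv_dt_apply_horizontal hf two_le_infty]
  congr 1
  have : ((τ, (0 : 𝔼²)) : ℝ × 𝔼²) = τ • ((1 : ℝ), (0 : 𝔼²)) := by simp
  rw [this, map_smul, smul_eq_mul]

/-- **The `s`-derivative of `μ` along the indicatrix**: `∂ₛμ = ∂ₛT · ∂λμ + ⟨∂λ∇F, k + ∂ₛA k′⟩`
(Cerf's `dμ/du`, 4°). [cite: CerfDiffeoSphere1968, Ch. II §2, 4°] -/
theorem fderiv_mu_apply_s (hF : ContDiff ℝ ∞ fun p : ℝ × (ℝ × 𝔼²) => F p.1 p.2)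
    {y : ℝ × ℝ} (hg : DifferentiableAt ℝ g y) :
    fderiv ℝ (fun y => dt (F y.1) (indPt z₀ k g y)) y (0, 1) =
      (fderiv ℝ g y (0, 1)).1 * fderiv ℝ (fun z => dt (F y.1) z) (indPt z₀ k g y) (1, 0) +
        ∑ j, (k + (fderiv ℝ g y (0, 1)).2 • rot k) j * d1t (F y.1) (indPt z₀ k g y) j := by
  -- chain rule through the jointly smooth `(u, z) ↦ dt (F u) z`
  have hG : HasFDerivAt (fun p : ℝ × (ℝ × 𝔼²) => dt (F p.1) p.2)
      (fderiv ℝ (fun p : ℝ × (ℝ × 𝔼²) => dt (F p.1) p.2) (y.1, indPt z₀ k g y))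
      (y.1, indPt z₀ k g y) := ((contDiff_dt_member hF).differentiable (by simp) _).hasFDerivAt
  have hinner : HasFDerivAt (fun y : ℝ × ℝ => (y.1, indPt z₀ k g y))
      ((ContinuousLinearMap.fst ℝ ℝ ℝ).prod (fderiv ℝ (indPt z₀ k g) y)) y :=
    hasFDerivAt_fst.prodMk ((hasFDerivAt_indPt hg.hasFDerivAt).differentiableAt.hasFDerivAt)
  have hcomp : HasFDerivAt (fun y => dt (F y.1) (indPt z₀ k g y))
      (fderiv ℝ (fun p : ℝ × (ℝ × 𝔼²) => dt (F p.1) p.2) (y.1, indPt z₀ k g y) ∘L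
        (ContinuousLinearMap.fst ℝ ℝ ℝ).prod (fderiv ℝ (indPt z₀ k g) y)) y := by
    have h := hG.comp y hinner; exact h
  rw [hcomp.fderiv]
  simp only [ContinuousLinearMap.comp_apply, ContinuousLinearMap.prod_apply,
    ContinuousLinearMap.coe_fst']
  rw [fderiv_indPt_apply_s hg]
  have hsplit := apply_eq_inl_add_inr
    (fderiv ℝ (fun p : ℝ × (ℝ × 𝔼²) => dt (F p.1) p.2) (y.1, indPt z₀ k g y)) (0 : ℝ)
    (((fderiv ℝ g y (0, 1)).1, k + (fderiv ℝ g y (0, 1)).2 • rot k) : ℝ × 𝔼²)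
  rw [hsplit, map_zero, zero_add]
  have hz : (fderiv ℝ (fun p : ℝ × (ℝ × 𝔼²) => dt (F p.1) p.2) (y.1, indPt z₀ k g y) ∘L
      ContinuousLinearMap.inr ℝ ℝ (ℝ × 𝔼²)) =
      fderiv ℝ (fun z => dt (F y.1) z) (indPt z₀ k g y) := by
    have hd : HasFDerivAt (fun p : ℝ × (ℝ × 𝔼²) => dt (F p.1) p.2)
        (fderiv ℝ (fun p : ℝ × (ℝ × 𝔼²) => dt (F p.1) p.2) (y.1, indPt z₀ k g y))
        (y.1, indPt z₀ k g y) := hG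
    exact (hasFDerivAt_curry_right (z := (y.1, indPt z₀ k g y)) hd).fderiv.symm ▸ rfl
  rw [hz, fderiv_dt_apply (contDiff_member hF y.1)]

end Identities

/-! ### Smoothness of the derived quantities along the indicatrix -/

section Smoothness

variable {F : ℝ → ℝ × 𝔼² → ℝ} {z₀ : ℝ × 𝔼²} {k : 𝔼²} {g : ℝ × ℝ → ℝ × ℝ}

/-- The indicatrix point is as smooth as `g`. [folklore] -/
theorem contDiffAt_indPt {n : WithTop ℕ∞} {y : ℝ × ℝ} (hg : ContDiffAt ℝ n g y) :
    ContDiffAt ℝ n (indPt z₀ k g) y := by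
  unfold indPt
  exact contDiffAt_const.add ((contDiffAt_fst.comp y hg).prodMk
    ((contDiffAt_snd.smul contDiffAt_const).add ((contDiffAt_snd.comp y hg).smul contDiffAt_const)))

/-- `y ↦ (u, γ y)` is as smooth as `g`. [folklore] -/
theorem contDiffAt_pair_indPt {n : WithTop ℕ∞} {y : ℝ × ℝ} (hg : ContDiffAt ℝ n g y) :
    ContDiffAt ℝ n (fun y : ℝ × ℝ => (y.1, indPt z₀ k g y)) y :=
  contDiffAt_fst.prodMk (contDiffAt_indPt hg)

/-- `∂ₛT` is `C²` where `g` is `C³`. [folklore] -/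
theorem contDiffAt_dT {y : ℝ × ℝ} (hg : ContDiffAt ℝ 3 g y) :
    ContDiffAt ℝ 2 (fun y => (fderiv ℝ g y (0, 1)).1) y := by
  have h1 : ContDiffAt ℝ 2 (fderiv ℝ g) y := hg.fderiv_right (m := 2) (by norm_num)
  exact contDiffAt_fst.comp y (h1.clm_apply contDiffAt_const)

/-- `∂ₛA` is `C²` where `g` is `C³`. [folklore] -/
theorem contDiffAt_dA {y : ℝ × ℝ} (hg : ContDiffAt ℝ 3 g y) :
    ContDiffAt ℝ 2 (fun y => (fderiv ℝ g y (0, 1)).2) y := by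
  have h1 : ContDiffAt ℝ 2 (fderiv ℝ g) y := hg.fderiv_right (m := 2) (by norm_num)
  exact contDiffAt_snd.comp y (h1.clm_apply contDiffAt_const)

/-- `μ` along the indicatrix is `C³` where `g` is. [folklore] -/
theorem contDiffAt_mu (hF : ContDiff ℝ ∞ fun p : ℝ × (ℝ × 𝔼²) => F p.1 p.2) {y : ℝ × ℝ}
    (hg : ContDiffAt ℝ 3 g y) : ContDiffAt ℝ 3 (fun y => dt (F y.1) (indPt z₀ k g y)) y := by
  have h := ((contDiff_dt_member hF).of_le (natCast_le_infty 3)).contDiffAt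
    (x := (y.1, indPt z₀ k g y)) |>.comp y (contDiffAt_pair_indPt (z₀ := z₀) (k := k) hg)
  exact h

/-- The value along the indicatrix is `C³` where `g` is. [folklore] -/
theorem contDiffAt_value (hF : ContDiff ℝ ∞ fun p : ℝ × (ℝ × 𝔼²) => F p.1 p.2) {y : ℝ × ℝ}
    (hg : ContDiffAt ℝ 3 g y) : ContDiffAt ℝ 3 (fun y => F y.1 (indPt z₀ k g y)) y := by
  have h := (hF.of_le (natCast_le_infty 3)).contDiffAt (x := (y.1, indPt z₀ k g y)) |>.comp y
    (contDiffAt_pair_indPt (z₀ := z₀) (k := k) hg)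
  exact h

end Smoothness

/-! ### The second `s`-derivative of `T` at the birth–death point: `∂ₛ∂ₛT(0) ⟨∂λ∇F, k⟩ = -C` -/

section SecondDerivative

variable {F : ℝ → ℝ × 𝔼² → ℝ} {z₀ : ℝ × 𝔼²} {k : 𝔼²} {g : ℝ × ℝ → ℝ × ℝ} {N : Set (ℝ × ℝ)}

/-- **Cerf's (9), second half: `d²λ/du² ≠ 0`.**  At the birth–death point (`y = 0`, `g 0 = 0`,
`∂ₛ g(0) = 0`) the second `s`-derivative of `T` satisfies `∂ₛ∂ₛT(0) · ⟨∂λ∇F, k⟩ = -C` with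
`C = ∑ kᵢ kⱼ ∂ₖ∂ᵢ∂ⱼ F 0 (z₀)` the cubic form on the kernel — obtained by differentiating the
identity `∂ₛT ⟨∂λ∇F, k⟩ + ⟨H(k + ∂ₛA k′), k⟩ = 0` once more.
[cite: CerfDiffeoSphere1968, Ch. II §2, (9) and 3° (iii)] -/
theorem ddT_mul_sum_eq (hF : ContDiff ℝ ∞ fun p : ℝ × (ℝ × 𝔼²) => F p.1 p.2)
    (hN : IsOpen N) (h0N : (0 : ℝ × ℝ) ∈ N) (hg : ∀ y ∈ N, ContDiffAt ℝ 3 g y)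
    (hE : ∀ y ∈ N, d1 (F y.1) (indPt z₀ k g y) = 0) (hg0 : g 0 = 0)
    (hds : fderiv ℝ g 0 (0, 1) = 0)
    (hk0 : d2 (F 0) z₀ 0 0 * k 0 + d2 (F 0) z₀ 0 1 * k 1 = 0)
    (hk1 : d2 (F 0) z₀ 0 1 * k 0 + d2 (F 0) z₀ 1 1 * k 1 = 0) :
    fderiv ℝ (fun y => (fderiv ℝ g y (0, 1)).1) 0 (0, 1) * (∑ j, k j * d1t (F 0) z₀ j) =
      -(∑ i, ∑ j, k i * k j * d3 (F 0) z₀ (0, k) i j) := by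
  have hF0 : ContDiff ℝ ∞ (F 0) := contDiff_member hF 0
  have hgd : ∀ y ∈ N, DifferentiableAt ℝ g y := fun y hy => (hg y hy).differentiableAt (by norm_num)
  have hpt0 : indPt z₀ k g ((0 : ℝ), (0 : ℝ)) = z₀ := by
    have : indPt z₀ k g 0 = z₀ := by rw [indPt_apply, hg0]; ext <;> simp
    exact this
  have hds' : fderiv ℝ g ((0 : ℝ), (0 : ℝ)) (0, 1) = 0 := hds
  have h0N' : (((0 : ℝ), (0 : ℝ)) : ℝ × ℝ) ∈ N := h0N
  -- the functions of `s` at `u = 0`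
  set Ts : ℝ → ℝ := fun σ => (fderiv ℝ g (0, σ) (0, 1)).1 with hTs
  set As : ℝ → ℝ := fun σ => (fderiv ℝ g (0, σ) (0, 1)).2 with hAs
  set γ : ℝ → ℝ × 𝔼² := fun σ => indPt z₀ k g (0, σ) with hγ
  set P : ℝ → ℝ := fun σ => ∑ j, k j * d1t (F 0) (γ σ) j with hP
  set Q : ℝ → ℝ := fun σ => ∑ i, k i * hessMul (F 0) (γ σ) (k + As σ • rot k) i with hQ
  -- the identity `Ts * P + Q = 0` near `0`
  have hNs : ∀ᶠ σ in 𝓝 (0 : ℝ), ((0 : ℝ), σ) ∈ N := by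
    have hc : Continuous fun σ : ℝ => ((0 : ℝ), σ) := continuous_const.prodMk continuous_id
    exact hc.continuousAt.preimage_mem_nhds (hN.mem_nhds h0N')
  have hident : (fun σ => Ts σ * P σ + Q σ) =ᶠ[𝓝 0] fun _ => (0 : ℝ) := by
    filter_upwards [hNs] with σ hσ
    have h := dT_mul_sum_eq hF hN hgd hE hσ
    simp only [hTs, hP, hQ, hγ, hAs]
    linarith
  -- derivatives at `σ = 0`
  have hTs0 : Ts 0 = 0 := by simp [hTs, hds']
  have hAs0 : As 0 = 0 := by simp [hAs, hds']
  have hγ0 : γ 0 = z₀ := by simp [hγ, hpt0]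
  -- `γ` has derivative `(0, k)` at `0`
  have hγd : HasDerivAt γ ((0 : ℝ), k) 0 := by
    have hgf : HasFDerivAt g (fderiv ℝ g (0, 0)) ((0 : ℝ), (0 : ℝ)) :=
      (hgd _ h0N').hasFDerivAt
    have hind := hasFDerivAt_indPt (z₀ := z₀) (k := k) hgf
    have hsl := hasDerivAt_sliceS (y := ((0 : ℝ), (0 : ℝ))) hind
    have hval : ((ContinuousLinearMap.fst ℝ ℝ ℝ ∘L fderiv ℝ g (0, 0)).prod
        ((ContinuousLinearMap.snd ℝ ℝ ℝ).smulRight k +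
          (ContinuousLinearMap.snd ℝ ℝ ℝ ∘L fderiv ℝ g (0, 0)).smulRight (rot k))) (0, 1) =
        ((0 : ℝ), k) := by
      simp [hds']
    rw [hval] at hsl
    exact hsl
  -- `Ts` is differentiable at `0` with derivative `Tss0`
  have hTsd : HasDerivAt Ts (fderiv ℝ (fun y => (fderiv ℝ g y (0, 1)).1) 0 (0, 1)) 0 := by
    have hdiff : DifferentiableAt ℝ (fun y => (fderiv ℝ g y (0, 1)).1) ((0 : ℝ), (0 : ℝ)) :=
      (contDiffAt_dT (hg _ h0N')).differentiableAt (by norm_num)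
    exact hasDerivAt_sliceS (y := ((0 : ℝ), (0 : ℝ))) hdiff.hasFDerivAt
  -- `As` is differentiable at `0`
  have hAsd : HasDerivAt As (fderiv ℝ (fun y => (fderiv ℝ g y (0, 1)).2) 0 (0, 1)) 0 := by
    have hdiff : DifferentiableAt ℝ (fun y => (fderiv ℝ g y (0, 1)).2) ((0 : ℝ), (0 : ℝ)) :=
      (contDiffAt_dA (hg _ h0N')).differentiableAt (by norm_num)
    exact hasDerivAt_sliceS (y := ((0 : ℝ), (0 : ℝ))) hdiff.hasFDerivAt
  set a₂ : ℝ := fderiv ℝ (fun y => (fderiv ℝ g y (0, 1)).2) 0 (0, 1) with ha₂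
  -- `P` is differentiable at `0`
  have hPd : HasDerivAt P (deriv P 0) 0 := by
    have hdiff : DifferentiableAt ℝ P 0 := by
      simp only [hP]
      refine DifferentiableAt.fun_sum fun j _ => ?_
      refine (differentiableAt_const _).mul ?_
      have hsm : ContDiff ℝ ∞ fun z => d1t (F 0) z j := by
        unfold d1t
        exact ((contDiff_d1 hF0 j).fderiv_right (m := ∞) (by simp)).clm_apply contDiff_const
      exact (hsm.differentiable (by simp) _).comp 0 hγd.differentiableAt
    exact hdiff.hasDerivAt
  -- the `d2`-terms along `γ` have derivative `d3 … (0, k)` at `0`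
  have hd2d : ∀ i j, HasDerivAt (fun σ => d2 (F 0) (γ σ) i j) (d3 (F 0) z₀ (0, k) i j) 0 := by
    intro i j
    have hfd : HasFDerivAt (fun z => d2 (F 0) z i j) (fderiv ℝ (fun z => d2 (F 0) z i j) z₀) (γ 0) := by
      rw [hγ0]; exact hasFDerivAt_d2 hF0 z₀ i j
    have h := hfd.comp_hasDerivAt 0 hγd
    rw [d3]
    exact h
  -- `Q` has derivative `C + a₂ · ⟨H k′, k⟩ = C` at `0`
  have hQd : HasDerivAt Q (∑ i, k i * (∑ j, (d3 (F 0) z₀ (0, k) i j * (k + As 0 • rot k) j +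
      d2 (F 0) (γ 0) i j * (a₂ * rot k j)))) 0 := by
    simp only [hQ, hessMul]
    refine HasDerivAt.fun_sum fun i _ => ?_
    refine HasDerivAt.const_mul (k i) ?_
    refine HasDerivAt.fun_sum fun j _ => ?_
    have hw : HasDerivAt (fun σ => (k + As σ • rot k) j) (a₂ * rot k j) 0 := by
      have hfun : (fun σ => (k + As σ • rot k) j) = fun σ => k j + As σ * rot k j := by
        funext σ; simp [smul_eq_mul]
      rw [hfun]
      exact (hAsd.mul_const (rot k j)).const_add (k j)
    have h := (hd2d i j).mul hw
    exact h
  -- differentiate the identity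
  have hφ : HasDerivAt (fun σ => Ts σ * P σ + Q σ)
      (fderiv ℝ (fun y => (fderiv ℝ g y (0, 1)).1) 0 (0, 1) * P 0 + Ts 0 * deriv P 0 +
        ∑ i, k i * (∑ j, (d3 (F 0) z₀ (0, k) i j * (k + As 0 • rot k) j +
          d2 (F 0) (γ 0) i j * (a₂ * rot k j)))) 0 := (hTsd.mul hPd).add hQd
  have hderiv0 : deriv (fun σ => Ts σ * P σ + Q σ) 0 = 0 := by
    rw [hident.deriv_eq]; simp
  rw [hφ.deriv] at hderiv0
  rw [hTs0, hAs0, hγ0, zero_mul, add_zero] at hderiv0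
  have hP0 : P 0 = ∑ j, k j * d1t (F 0) z₀ j := by simp [hP, hγ0]
  rw [hP0] at hderiv0
  -- the `a₂`-term vanishes: `⟨H k′, k⟩ = 0`
  have hs : d2 (F 0) z₀ 1 0 = d2 (F 0) z₀ 0 1 := d2_symm hF0.contDiffAt two_le_infty 1 0
  have horth : ∑ i, k i * ∑ j, d2 (F 0) z₀ i j * (a₂ * rot k j) = 0 := by
    simp only [Fin.sum_univ_two, rot_apply_zero, rot_apply_one, hs]
    linear_combination (-(a₂ * k 1)) * hk0 + (a₂ * k 0) * hk1
  have hsplit : ∑ i, k i * (∑ j, (d3 (F 0) z₀ (0, k) i j * (k + (0 : ℝ) • rot k) j +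
      d2 (F 0) z₀ i j * (a₂ * rot k j))) =
      (∑ i, ∑ j, k i * k j * d3 (F 0) z₀ (0, k) i j) +
        ∑ i, k i * ∑ j, d2 (F 0) z₀ i j * (a₂ * rot k j) := by
    simp only [zero_smul, add_zero, Finset.mul_sum, ← Finset.sum_add_distrib]
    refine Finset.sum_congr rfl fun i _ => Finset.sum_congr rfl fun j _ => ?_
    ring
  rw [hsplit, horth, add_zero] at hderiv0
  linarith

end SecondDerivative

/-! ### Lemme 8, uniformly in the parameter `u` -/

section Lemma8

variable {F : ℝ → ℝ × 𝔼² → ℝ} {z₀ : ℝ × 𝔼²} {k : 𝔼²} {g : ℝ × ℝ → ℝ × ℝ} {N : Set (ℝ × ℝ)}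

/-- Continuity of `∂ₛ∂ₛT` where `g` is `C³`. [folklore] -/
theorem continuousAt_ddT {y : ℝ × ℝ} (hg : ContDiffAt ℝ 3 g y) :
    ContinuousAt (fun y => fderiv ℝ (fun y => (fderiv ℝ g y (0, 1)).1) y (0, 1)) y := by
  have h1 : ContDiffAt ℝ 1 (fderiv ℝ (fun y => (fderiv ℝ g y (0, 1)).1)) y :=
    (contDiffAt_dT hg).fderiv_right (m := 1) (by norm_num)
  exact (h1.continuousAt.clm_apply continuousAt_const)

/-- Continuity of `∂ₛμ` where `g` is `C³`. [folklore] -/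
theorem continuousAt_dmu (hF : ContDiff ℝ ∞ fun p : ℝ × (ℝ × 𝔼²) => F p.1 p.2) {y : ℝ × ℝ}
    (hg : ContDiffAt ℝ 3 g y) :
    ContinuousAt (fun y => fderiv ℝ (fun y => dt (F y.1) (indPt z₀ k g y)) y (0, 1)) y := by
  have h1 : ContDiffAt ℝ 2 (fderiv ℝ (fun y => dt (F y.1) (indPt z₀ k g y))) y :=
    (contDiffAt_mu hF hg).fderiv_right (m := 2) (by norm_num)
  exact (h1.continuousAt.clm_apply continuousAt_const)

/-- **Cerf's Lemme 8 near a birth–death point, uniformly in an auxiliary parameter.**  In the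
setting of `exists_indicatrix` (the critical points of the slices of `F u` near `z₀` are
`γ(u, s) = z₀ + (T(u,s), s k + A(u,s) k′)`, `g = (T, A)` of class `C³` near `0`, `g 0 = 0`,
`∂ₛg(0) = 0`), assume Cerf's two non-degeneracy conditions of a correct path at the point: the
rank condition `⟨∂λ∇F, k⟩ ≠ 0` and the `A₂` condition `C ≠ 0` (cubic form on the kernel).  Then
there is `ε > 0` such that for `|u| < ε` and `s₁ ≠ s₂` in `(-ε, ε)` with the SAME time
`T(u, s₁) = T(u, s₂)`, the two critical points `γ(u, s₁)`, `γ(u, s₂)` of that slice have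
DIFFERENT values.  (For `u` frozen this is Lemme 8: the graphic of a correct path is injective
near a cusp; the mechanism is (9)–(10): `∂ₛ∂ₛT ≠ 0`, `∂ₛμ ≠ 0`, `∂ₛZ = μ ∂ₛT`, through
`CerfCuspLemma.ne_of_hasDerivAt_eq_mul`.)
[cite: CerfDiffeoSphere1968, Ch. II §2, Lemme 8 with (9)–(10)] -/
theorem exists_cusp_injective (hF : ContDiff ℝ ∞ fun p : ℝ × (ℝ × 𝔼²) => F p.1 p.2)
    (hN : IsOpen N) (h0N : (0 : ℝ × ℝ) ∈ N) (hg : ∀ y ∈ N, ContDiffAt ℝ 3 g y)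
    (hE : ∀ y ∈ N, d1 (F y.1) (indPt z₀ k g y) = 0) (hg0 : g 0 = 0)
    (hds : fderiv ℝ g 0 (0, 1) = 0)
    (hk0 : d2 (F 0) z₀ 0 0 * k 0 + d2 (F 0) z₀ 0 1 * k 1 = 0)
    (hk1 : d2 (F 0) z₀ 0 1 * k 0 + d2 (F 0) z₀ 1 1 * k 1 = 0)
    (hv : ∑ j, k j * d1t (F 0) z₀ j ≠ 0)
    (hC : ∑ i, ∑ j, k i * k j * d3 (F 0) z₀ (0, k) i j ≠ 0) :
    ∃ ε > 0, ∀ u s₁ s₂ : ℝ, |u| < ε → s₁ ∈ Ioo (-ε) ε → s₂ ∈ Ioo (-ε) ε → s₁ ≠ s₂ →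
      (g (u, s₁)).1 = (g (u, s₂)).1 →
        F u (indPt z₀ k g (u, s₁)) ≠ F u (indPt z₀ k g (u, s₂)) := by
  have hgd : ∀ y ∈ N, DifferentiableAt ℝ g y := fun y hy => (hg y hy).differentiableAt (by norm_num)
  have h0N' : (((0 : ℝ), (0 : ℝ)) : ℝ × ℝ) ∈ N := h0N
  have hds' : fderiv ℝ g ((0 : ℝ), (0 : ℝ)) (0, 1) = 0 := hds
  have hpt0 : indPt z₀ k g ((0 : ℝ), (0 : ℝ)) = z₀ := by
    have : indPt z₀ k g 0 = z₀ := by rw [indPt_apply, hg0]; ext <;> simp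
    exact this
  -- the second derivatives as functions of `y`
  obtain ⟨Tss, hTss⟩ : ∃ Tss : ℝ × ℝ → ℝ,
      Tss = fun y => fderiv ℝ (fun y => (fderiv ℝ g y (0, 1)).1) y (0, 1) := ⟨_, rfl⟩
  obtain ⟨Mus, hMus⟩ : ∃ Mus : ℝ × ℝ → ℝ,
      Mus = fun y => fderiv ℝ (fun y => dt (F y.1) (indPt z₀ k g y)) y (0, 1) := ⟨_, rfl⟩
  -- their values at `0`
  have hTss0 : Tss 0 ≠ 0 := by
    intro h0
    have key := ddT_mul_sum_eq hF hN h0N hg hE hg0 hds hk0 hk1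
    have h0' : fderiv ℝ (fun y => (fderiv ℝ g y (0, 1)).1) 0 (0, 1) = 0 := by
      rw [hTss] at h0; exact h0
    rw [h0', zero_mul] at key
    exact hC (by linarith)
  have hMus0 : Mus 0 ≠ 0 := by
    have hval : Mus 0 = ∑ j, k j * d1t (F 0) z₀ j := by
      rw [hMus]
      change fderiv ℝ (fun y => dt (F y.1) (indPt z₀ k g y)) ((0 : ℝ), (0 : ℝ)) (0, 1) = _
      rw [fderiv_mu_apply_s hF (hgd _ h0N'), hds', hpt0]
      simp
    rw [hval]; exact hv
  -- continuity on `N`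
  have hTssc : ∀ y ∈ N, ContinuousAt Tss y := fun y hy => by
    rw [hTss]; exact continuousAt_ddT (hg y hy)
  have hMusc : ∀ y ∈ N, ContinuousAt Mus y := fun y hy => by
    rw [hMus]; exact continuousAt_dmu hF (hg y hy)
  -- a ball on which everything holds
  obtain ⟨ε, hε, hball⟩ : ∃ ε > 0, ball (0 : ℝ × ℝ) ε ⊆ N ∩ {y | Tss y ≠ 0} ∩ {y | Mus y ≠ 0} := by
    have h1 : N ∈ 𝓝 (0 : ℝ × ℝ) := hN.mem_nhds h0N
    have h2 : {y | Tss y ≠ 0} ∈ 𝓝 (0 : ℝ × ℝ) := (hTssc 0 h0N).eventually_ne hTss0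
    have h3 : {y | Mus y ≠ 0} ∈ 𝓝 (0 : ℝ × ℝ) := (hMusc 0 h0N).eventually_ne hMus0
    exact Metric.mem_nhds_iff.1 (Filter.inter_mem (Filter.inter_mem h1 h2) h3)
  refine ⟨ε, hε, fun u s₁ s₂ hu hs₁ hs₂ hne heq => ?_⟩
  -- points of the box are in the ball (sup norm)
  have hmem : ∀ σ ∈ Ioo (-ε) ε, ((u, σ) : ℝ × ℝ) ∈ ball (0 : ℝ × ℝ) ε := fun σ hσ => by
    rw [mem_ball_zero_iff, Prod.norm_def, max_lt_iff]
    exact ⟨by simpa [Real.norm_eq_abs] using hu, by simpa [Real.norm_eq_abs, abs_lt] using hσ⟩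
  have hN' : ∀ σ ∈ Ioo (-ε) ε, ((u, σ) : ℝ × ℝ) ∈ N := fun σ hσ => (hball (hmem σ hσ)).1.1
  -- apply the cusp lemma to the `u`-slice
  refine ne_of_hasDerivAt_eq_mul (a := -ε) (b := ε)
    (T := fun σ => (g (u, σ)).1) (T' := fun σ => (fderiv ℝ g (u, σ) (0, 1)).1)
    (T'' := fun σ => Tss (u, σ)) (M := fun σ => dt (F u) (indPt z₀ k g (u, σ)))
    (M' := fun σ => Mus (u, σ)) (Z := fun σ => F u (indPt z₀ k g (u, σ)))
    ?_ ?_ ?_ ?_ ?_ ?_ ?_ ?_ hs₁ hs₂ hne heq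
  · intro σ hσ
    have hd : HasFDerivAt (fun y => (g y).1) (ContinuousLinearMap.fst ℝ ℝ ℝ ∘L fderiv ℝ g (u, σ)) (u, σ) :=
      hasFDerivAt_fst.comp (u, σ) (hgd _ (hN' σ hσ)).hasFDerivAt
    exact hasDerivAt_sliceS (y := (u, σ)) hd
  · intro σ hσ
    have hd : DifferentiableAt ℝ (fun y => (fderiv ℝ g y (0, 1)).1) (u, σ) :=
      (contDiffAt_dT (hg _ (hN' σ hσ))).differentiableAt (by norm_num)
    have h := hasDerivAt_sliceS (y := (u, σ)) hd.hasFDerivAt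
    rw [hTss]; exact h
  · intro σ hσ
    have hc : ContinuousAt (fun σ : ℝ => ((u, σ) : ℝ × ℝ)) σ :=
      (continuous_const.prodMk continuous_id).continuousAt
    exact ((hTssc _ (hN' σ hσ)).comp hc).continuousWithinAt
  · exact fun σ hσ => (hball (hmem σ hσ)).1.2
  · intro σ hσ
    have hd : DifferentiableAt ℝ (fun y => dt (F y.1) (indPt z₀ k g y)) (u, σ) :=
      (contDiffAt_mu hF (hg _ (hN' σ hσ))).differentiableAt (by norm_num)
    have h := hasDerivAt_sliceS (y := (u, σ)) hd.hasFDerivAt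
    rw [hMus]; exact h
  · intro σ hσ
    have hc : ContinuousAt (fun σ : ℝ => ((u, σ) : ℝ × ℝ)) σ :=
      (continuous_const.prodMk continuous_id).continuousAt
    exact ((hMusc _ (hN' σ hσ)).comp hc).continuousWithinAt
  · exact fun σ hσ => (hball (hmem σ hσ)).2
  · intro σ hσ
    have hd : DifferentiableAt ℝ (fun y => F y.1 (indPt z₀ k g y)) (u, σ) :=
      (contDiffAt_value hF (hg _ (hN' σ hσ))).differentiableAt (by norm_num)
    have h := hasDerivAt_sliceS (y := (u, σ)) hd.hasFDerivAt
    rw [fderiv_value_apply_s hF (hgd _ (hN' σ hσ)) (hE _ (hN' σ hσ))] at h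
    exact h

end Lemma8

/-! ### Coordinates in the frame `(k, k′)` and the master statement -/

section Master

variable {k : 𝔼²}

/-- The `k`-coordinate of a plane vector in the orthogonal frame `(k, k′)`. [folklore] -/
def sCoord (k x : 𝔼²) : ℝ := (x 0 * k 0 + x 1 * k 1) / (k 0 ^ 2 + k 1 ^ 2)

/-- The `k′`-coordinate of a plane vector in the orthogonal frame `(k, k′)`. [folklore] -/
def aCoord (k x : 𝔼²) : ℝ := (-(x 0) * k 1 + x 1 * k 0) / (k 0 ^ 2 + k 1 ^ 2)

/-- `k₀² + k₁² ≠ 0` for `k ≠ 0`. [folklore] -/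
theorem normSq_ne_zero (hk : k ≠ 0) : k 0 ^ 2 + k 1 ^ 2 ≠ 0 := by
  intro h0
  apply hk
  have e0 : k 0 = 0 := by nlinarith
  have e1 : k 1 = 0 := by nlinarith
  ext i; fin_cases i <;> simp [e0, e1]

/-- **Decomposition in the frame**: `x = sCoord k x • k + aCoord k x • k′`. [folklore] -/
theorem eq_sCoord_smul_add (hk : k ≠ 0) (x : 𝔼²) :
    x = sCoord k x • k + aCoord k x • rot k := by
  have hn := normSq_ne_zero hk
  ext i
  fin_cases i
  · simp only [sCoord, aCoord, PiLp.add_apply, PiLp.smul_apply, smul_eq_mul, rot_apply_zero,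
      Fin.zero_eta, Fin.isValue]
    field_simp
    ring
  · simp only [sCoord, aCoord, PiLp.add_apply, PiLp.smul_apply, smul_eq_mul, rot_apply_one,
      Fin.mk_one, Fin.isValue]
    field_simp
    ring

/-- The frame coordinates of `s k + a k′` are `(s, a)`. [folklore] -/
theorem sCoord_aCoord_smul_add (hk : k ≠ 0) (σ a : ℝ) :
    sCoord k (σ • k + a • rot k) = σ ∧ aCoord k (σ • k + a • rot k) = a := by
  have hn := normSq_ne_zero hk
  constructor
  · simp only [sCoord, PiLp.add_apply, PiLp.smul_apply, smul_eq_mul, rot_apply_zero, rot_apply_one]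
    field_simp
    ring
  · simp only [aCoord, PiLp.add_apply, PiLp.smul_apply, smul_eq_mul, rot_apply_zero, rot_apply_one]
    field_simp
    ring

/-- The frame coordinates are continuous. [folklore] -/
theorem continuous_sCoord (k : 𝔼²) : Continuous (sCoord k) := by
  unfold sCoord
  fun_prop

/-- The frame coordinates are continuous. [folklore] -/
theorem continuous_aCoord (k : 𝔼²) : Continuous (aCoord k) := by
  unfold aCoord
  fun_prop

/-- `sCoord k 0 = 0`. [folklore] -/
@[simp] theorem sCoord_zero (k : 𝔼²) : sCoord k 0 = 0 := by simp [sCoord]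

/-- `aCoord k 0 = 0`. [folklore] -/
@[simp] theorem aCoord_zero (k : 𝔼²) : aCoord k 0 = 0 := by simp [aCoord]

/-- `‖x‖² = x₀² + x₁²` on the Euclidean plane. [folklore] -/
theorem norm_sq_eq_two (x : 𝔼²) : ‖x‖ ^ 2 = x 0 ^ 2 + x 1 ^ 2 := by
  rw [EuclideanSpace.norm_eq, Real.sq_sqrt (Finset.sum_nonneg fun i _ => sq_nonneg _)]
  simp [Fin.sum_univ_two, sq_abs]

/-- For a unit vector `k`, `k₀² + k₁² = 1`. [folklore] -/
theorem normSq_eq_one_of_norm_eq_one (hk : ‖k‖ = 1) : k 0 ^ 2 + k 1 ^ 2 = 1 := by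
  rw [← norm_sq_eq_two, hk, one_pow]

/-- **Cauchy–Schwarz for the frame coordinates of a unit vector**: `|sCoord k x| ≤ ‖x‖`.
[folklore] -/
theorem abs_sCoord_le (hk : ‖k‖ = 1) (x : 𝔼²) : |sCoord k x| ≤ ‖x‖ := by
  have h1 := normSq_eq_one_of_norm_eq_one hk
  have hx := norm_sq_eq_two x
  have hs : sCoord k x = x 0 * k 0 + x 1 * k 1 := by simp [sCoord, h1]
  rw [hs]
  refine abs_le_of_sq_le_sq ?_ (norm_nonneg x)
  rw [hx]
  nlinarith [sq_nonneg (x 0 * k 1 - x 1 * k 0), h1]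

/-- **Cauchy–Schwarz for the frame coordinates of a unit vector**: `|aCoord k x| ≤ ‖x‖`.
[folklore] -/
theorem abs_aCoord_le (hk : ‖k‖ = 1) (x : 𝔼²) : |aCoord k x| ≤ ‖x‖ := by
  have h1 := normSq_eq_one_of_norm_eq_one hk
  have hx := norm_sq_eq_two x
  have hs : aCoord k x = -(x 0) * k 1 + x 1 * k 0 := by simp [aCoord, h1]
  rw [hs]
  refine abs_le_of_sq_le_sq ?_ (norm_nonneg x)
  rw [hx]
  nlinarith [sq_nonneg (x 0 * k 0 + x 1 * k 1), h1]

variable {F : ℝ → ℝ × 𝔼² → ℝ} {z₀ : ℝ × 𝔼²}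

/-- **The birth–death chart of a correct family (master statement).**  Let `F u` be a jointly
smooth one-parameter family of paths of functions on the plane and `z₀ = (λ₀, x₀)` a point
where the slice of `F 0` is critical with degenerate, non-zero Hessian and where the path `F 0`
is correct (Cerf's Déf. 1: `(λ, x, y) ↦ (p, q, δ)` has onto derivative).  Then there are a UNIT
kernel direction `k`, a map `g = (T, A)` and `ε > 0` such that: `g 0 = 0`, `g` is `C³` on the
`ε`-ball, the points `γ(u,s) = z₀ + (T(u,s), s k + A(u,s) k′)` are critical for the slices of
`F u` (`‖(u, s)‖ < ε`), `∂ₛ g(0) = 0`, Cerf's rank and `A₂` conditions hold; EVERY critical point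
`z` of a slice of `F u` with `|u| < ε`, `dist z z₀ < ε` is `γ(u, s)` with
`s = sCoord k (z.2 - z₀.2)`, `|s| < ε` (uniqueness, implicit function theorem); and (Lemme 8)
two distinct parameters `s₁ ≠ s₂` with the same time `T` give distinct values.
[cite: CerfDiffeoSphere1968, Ch. II §2, 1°–4°, (9), (10), Lemme 8] -/
theorem exists_birthDeath_chart (hF : ContDiff ℝ ∞ fun p : ℝ × (ℝ × 𝔼²) => F p.1 p.2)
    (hcrit : d1 (F 0) z₀ = 0) (hdeg : hessDet (F 0) z₀ = 0) (hjet : jet2 (F 0) z₀ ≠ 0)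
    (hcorr : Surjective (fderiv ℝ (fun z => (d1 (F 0) z, hessDet (F 0) z)) z₀)) :
    ∃ (k : 𝔼²) (g : ℝ × ℝ → ℝ × ℝ) (ε : ℝ), ‖k‖ = 1 ∧ 0 < ε ∧ g 0 = 0 ∧
      d2 (F 0) z₀ 0 0 * k 0 + d2 (F 0) z₀ 0 1 * k 1 = 0 ∧
      d2 (F 0) z₀ 0 1 * k 0 + d2 (F 0) z₀ 1 1 * k 1 = 0 ∧
      (∀ y ∈ ball (0 : ℝ × ℝ) ε, ContDiffAt ℝ 3 g y) ∧
      (∀ y ∈ ball (0 : ℝ × ℝ) ε, d1 (F y.1) (indPt z₀ k g y) = 0) ∧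
      fderiv ℝ g 0 (0, 1) = 0 ∧
      (∑ j, k j * d1t (F 0) z₀ j ≠ 0) ∧
      (∑ i, ∑ j, k i * k j * d3 (F 0) z₀ (0, k) i j ≠ 0) ∧
      (∀ (u : ℝ) (z : ℝ × 𝔼²), |u| < ε → dist z z₀ < ε → d1 (F u) z = 0 →
        |sCoord k (z.2 - z₀.2)| < ε ∧ z = indPt z₀ k g (u, sCoord k (z.2 - z₀.2))) ∧
      (∀ u s₁ s₂ : ℝ, |u| < ε → s₁ ∈ Ioo (-ε) ε → s₂ ∈ Ioo (-ε) ε → s₁ ≠ s₂ →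
        (g (u, s₁)).1 = (g (u, s₂)).1 →
          F u (indPt z₀ k g (u, s₁)) ≠ F u (indPt z₀ k g (u, s₂))) := by
  have hF0 : ContDiff ℝ ∞ (F 0) := contDiff_member hF 0
  -- a unit kernel direction
  have hδ : d2 (F 0) z₀ 0 0 * d2 (F 0) z₀ 1 1 - d2 (F 0) z₀ 0 1 ^ 2 = 0 := hdeg
  obtain ⟨k₀, hk₀, hk₀0, hk₀1⟩ := exists_kernel hδ
  have hnk₀ : ‖k₀‖ ≠ 0 := norm_ne_zero_iff.2 hk₀
  set k : 𝔼² := ‖k₀‖⁻¹ • k₀ with hkdef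
  have hkunit : ‖k‖ = 1 := by
    rw [hkdef, norm_smul, norm_inv, norm_norm, inv_mul_cancel₀ hnk₀]
  have hk : k ≠ 0 := by
    intro h; rw [h, norm_zero] at hkunit; exact zero_ne_one hkunit
  have hk0 : d2 (F 0) z₀ 0 0 * k 0 + d2 (F 0) z₀ 0 1 * k 1 = 0 := by
    simp only [hkdef, PiLp.smul_apply, smul_eq_mul]
    have := congrArg (fun r => ‖k₀‖⁻¹ * r) hk₀0
    simp only [mul_zero] at this
    linarith [this]
  have hk1 : d2 (F 0) z₀ 0 1 * k 0 + d2 (F 0) z₀ 1 1 * k 1 = 0 := by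
    simp only [hkdef, PiLp.smul_apply, smul_eq_mul]
    have := congrArg (fun r => ‖k₀‖⁻¹ * r) hk₀1
    simp only [mul_zero] at this
    linarith [this]
  have hv := sum_kernel_d1t_ne_zero hF0 hk hk0 hk1 hcorr
  have hC := cubic_kernel_ne_zero hF0 hk hk0 hk1 hcorr
  -- the indicatrix
  obtain ⟨g, hg0, hgs, hgsol, hguniq, hds, -⟩ := exists_indicatrix hF hk hk0 hk1 hjet hcrit hv
  -- a ball on which `g` is `C³` and the identity holds
  have hg3 : ∀ᶠ y in 𝓝 (0 : ℝ × ℝ), ContDiffAt ℝ 3 g y :=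
    (hgs.of_le (natCast_le_infty 3)).eventually (by simp)
  obtain ⟨ε₁, hε₁, hball₁⟩ : ∃ ε₁ > 0, ball (0 : ℝ × ℝ) ε₁ ⊆
      {y | ContDiffAt ℝ 3 g y} ∩ {y | d1 (F y.1) (indPt z₀ k g y) = 0} :=
    Metric.mem_nhds_iff.1 (Filter.inter_mem hg3 hgsol)
  -- Lemme 8 on that ball
  obtain ⟨ε₂, hε₂, hL8⟩ := exists_cusp_injective (N := ball (0 : ℝ × ℝ) ε₁) hF isOpen_ball
    (mem_ball_self hε₁) (fun y hy => (hball₁ hy).1) (fun y hy => (hball₁ hy).2) hg0 hds hk0 hk1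
    hv hC
  -- uniqueness holds on a ball of `(ℝ × ℝ) × (ℝ × ℝ)`
  obtain ⟨ε₃, hε₃, hball₃⟩ : ∃ ε₃ > 0, ball (0 : (ℝ × ℝ) × (ℝ × ℝ)) ε₃ ⊆
      {q | d1 (F q.2.1) (z₀ + (q.1.1, q.2.2 • k + q.1.2 • rot k)) = 0 → q.1 = g q.2} :=
    Metric.mem_nhds_iff.1 hguniq
  -- the final radius
  set ε : ℝ := min (min ε₁ ε₂) ε₃ with hεdef
  have hε : 0 < ε := lt_min (lt_min hε₁ hε₂) hε₃
  have hεle₁ : ε ≤ ε₁ := le_trans (min_le_left _ _) (min_le_left _ _)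
  have hεle₂ : ε ≤ ε₂ := le_trans (min_le_left _ _) (min_le_right _ _)
  have hεle₃ : ε ≤ ε₃ := min_le_right _ _
  refine ⟨k, g, ε, hkunit, hε, hg0, hk0, hk1, ?_, ?_, hds, hv, hC, ?_, ?_⟩
  · exact fun y hy => (hball₁ (ball_subset_ball hεle₁ hy)).1
  · exact fun y hy => (hball₁ (ball_subset_ball hεle₁ hy)).2
  · intro u z hu hz hcritz
    -- frame coordinates of `z - z₀`
    set τ : ℝ := z.1 - z₀.1 with hτ
    set σ : ℝ := sCoord k (z.2 - z₀.2) with hσ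
    set a : ℝ := aCoord k (z.2 - z₀.2) with ha
    have hx := eq_sCoord_smul_add hk (z.2 - z₀.2)
    have hzeq : z = z₀ + ((τ : ℝ), σ • k + a • rot k) := by
      refine Prod.ext ?_ ?_
      · simp [hτ]
      · rw [Prod.snd_add]
        change z.2 = z₀.2 + (sCoord k (z.2 - z₀.2) • k + aCoord k (z.2 - z₀.2) • rot k)
        rw [← hx]; abel
    -- size of the coordinates
    have hdist2 : ‖z.2 - z₀.2‖ ≤ dist z z₀ := by
      rw [Prod.dist_eq, ← dist_eq_norm]; exact le_max_right _ _
    have hσlt : |σ| < ε := lt_of_le_of_lt ((abs_sCoord_le hkunit _).trans hdist2) hz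
    have halt : |a| < ε := lt_of_le_of_lt ((abs_aCoord_le hkunit _).trans hdist2) hz
    have hτlt : |τ| < ε := by
      have h1 : |τ| = dist z.1 z₀.1 := by rw [hτ, Real.dist_eq]
      rw [h1]
      exact lt_of_le_of_lt (by rw [Prod.dist_eq]; exact le_max_left _ _) hz
    -- the point `((τ, a), (u, σ))` is in the uniqueness ball
    have hq : (((τ, a), (u, σ)) : (ℝ × ℝ) × (ℝ × ℝ)) ∈ ball (0 : (ℝ × ℝ) × (ℝ × ℝ)) ε₃ := by
      rw [mem_ball_zero_iff, Prod.norm_def, Prod.norm_def, Prod.norm_def]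
      simp only [Real.norm_eq_abs, max_lt_iff]
      exact ⟨⟨hτlt.trans_le hεle₃, halt.trans_le hεle₃⟩, hu.trans_le hεle₃, hσlt.trans_le hεle₃⟩
    have huniq := hball₃ hq
    have hcrit' : d1 (F u) (z₀ + ((τ : ℝ), σ • k + a • rot k)) = 0 := by
      rw [← hzeq]; exact hcritz
    have hg_eq : ((τ, a) : ℝ × ℝ) = g (u, σ) := huniq hcrit'
    refine ⟨hσlt, ?_⟩
    rw [indPt_apply, ← hg_eq]
    exact hzeq
  · intro u s₁ s₂ hu hs₁ hs₂ hne heq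
    exact hL8 u s₁ s₂ (lt_of_lt_of_le hu hεle₂) ⟨lt_of_le_of_lt (neg_le_neg hεle₂) hs₁.1,
      lt_of_lt_of_le hs₁.2 hεle₂⟩ ⟨lt_of_le_of_lt (neg_le_neg hεle₂) hs₂.1,
      lt_of_lt_of_le hs₂.2 hεle₂⟩ hne heq

/-- **Cerf's Lemme 8 in its consumable form: near a birth–death point of a correct path (with a
parameter), two distinct critical points of one slice have distinct critical values.**  There is
a neighbourhood `W` of `(0, z₀)` in `ℝ × (ℝ × ℝ²)` such that for `(u, z), (u, z′) ∈ W` with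
`z ≠ z′` at the same time `z.1 = z′.1`, both critical for the slice of `F u`, the values differ.
("Il existe un voisinage `𝒲` de la diagonale … tel que `γ²(𝒲 - Δ)` ne rencontre pas la
diagonale de `(I × ℝ)²`" — Lemme 7, 2° / Lemme 8.) [cite: CerfDiffeoSphere1968, Ch. II §2, Lemme 7 2° and Lemme 8] -/
theorem exists_nhds_critical_values_ne (hF : ContDiff ℝ ∞ fun p : ℝ × (ℝ × 𝔼²) => F p.1 p.2)
    (hcrit : d1 (F 0) z₀ = 0) (hdeg : hessDet (F 0) z₀ = 0) (hjet : jet2 (F 0) z₀ ≠ 0)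
    (hcorr : Surjective (fderiv ℝ (fun z => (d1 (F 0) z, hessDet (F 0) z)) z₀)) :
    ∃ ε > 0, ∀ (u : ℝ) (z z' : ℝ × 𝔼²), |u| < ε → dist z z₀ < ε → dist z' z₀ < ε →
      d1 (F u) z = 0 → d1 (F u) z' = 0 → z ≠ z' → z.1 = z'.1 → F u z ≠ F u z' := by
  obtain ⟨k, g, ε, -, hε, -, -, -, -, -, -, -, -, huniq, hL8⟩ :=
    exists_birthDeath_chart hF hcrit hdeg hjet hcorr
  refine ⟨ε, hε, fun u z z' hu hz hz' hc hc' hne ht => ?_⟩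
  obtain ⟨hs, hzeq⟩ := huniq u z hu hz hc
  obtain ⟨hs', hzeq'⟩ := huniq u z' hu hz' hc'
  set σ := sCoord k (z.2 - z₀.2)
  set σ' := sCoord k (z'.2 - z₀.2)
  have hσne : σ ≠ σ' := by
    intro h; apply hne; rw [hzeq, hzeq', h]
  have hT : (g (u, σ)).1 = (g (u, σ')).1 := by
    have h1 := congrArg Prod.fst hzeq
    have h2 := congrArg Prod.fst hzeq'
    simp only [indPt_apply, Prod.fst_add] at h1 h2
    linarith
  have h := hL8 u σ σ' hu (abs_lt.1 hs) (abs_lt.1 hs') hσne hT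
  rw [← hzeq, ← hzeq'] at h
  exact h

end Master

end CerfPath

end Literature.Topology.FourManifolds
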